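import Summits.QuantumFields.BalabanUV.T4Continuum.Support.B13InnerData
import Summits.QuantumFields.BalabanUV.T4Continuum.Support.B13CarriersTranslation
import Summits.QuantumFields.BalabanUV.T4Continuum.Support.B13DomainGeometryTR

/-!
# NE5 ∕ U3, crux O1, row O1-d1 follower (iii-a) — `B13StepTermShift`: the translations of the output torus `π_k` INDUCED ON EVERY
# LEVEL a (2.13)-term label touches (cubes of `π_j`, sites of `T^{(i)}`, domains, sigma cubes, bonds) as GROUP HOMOMORPHISMS ∕ ACTIONS,
# and their INTERTWINING with coarsening in the meaningful range of scales (part 1 of 3 of the anchored coding of record, design v0.3 R9)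

Cell `pub-balaban`, unit `b2b-balaban-t4-ne5-formalise-leaf-02` (NE5 formalisation swarm, leaf prover 02 — holder lineage of row
O1-d1 of `t4/b2b-balaban-t4-ne5-p1/O1-CLAIM-TABLE-NE5-P1.md` v1.3; journal INTENT l.8957; design `B13StepDesign.md` v0.3 RULING R9
«anchored term labels»).  Summits-side NEW WORK under the LEAN PLACEMENT RULE (cell modelling + kernel-checked bookkeeping on the swarm's
objects of record; nothing of the manuscripts under audit is asserted — [II] = [Balaban1988RG2Cluster] and [Balaban1987RG1] are cited
for KIND∕locus only).
HONEST FRAMING: rung (B)+1 bookkeeping for the FINITE-VOLUME T⁴ programme — NOT the continuum limit by itself, NOT infinite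
volume, NOT a mass gap, NOT Clay; NE5 NOT PROVED; spine 0∕9.  HONEST DEPENDENCY (cell line, verbatim): continuum YM on T⁴ ⇐ BetaPertH
∧ nine spine estimates (0/9 proved); BetaPertH ⇐ (D1) ∧ (D4) ∧ CAP+tail; G-an2-4 gates asym, D1 and NE2/3/4.

WHY.  Design v0.3 R9 (adopting this row's finding, journal l.5621) rules that term labels of record are SHAPES RELATIVE TO `X` — coded
translation-covariantly through O1-a's torus translations.  A label `(Z; Z₀, 𝐃, P)` of the step with output level `k` refers to THREE
lattices at once: the polymers `Z` are domains of `π_k` (`N_k = R.cubesPerDir k = 2·L^{m+K−k−m′}` cubes per direction), `Z₀` and `𝐃` are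
domains of `π_{k−1}` (`N_{k−1} = L·N_k`), the bonds `P` live on `T^{(k−1)}` (`L^{m′}·N_{k−1}` sites per direction).  A translation of
`π_k` by `v` must therefore be pushed to the finer levels — by `L^{k−j}·v` on `π_j`, by `L^{k+m′−i}·v` on `T^{(i)}` — compatibly with the
integer-division maps `B13InnerData.coarsen` ∕ `B13CarriersFootprint.toCube` that the labels' well-formedness uses.  This file supplies
exactly that; `B13StepTermTranslate` (part 2) moves the labels and proves covariance of localization; `B13StepTermCoding` (part 3) is
the anchored coding of record.

WHAT IS PROVED (kernel-checked; every `def` is data; imports BY NAME `B13InnerData`, leaf-05's `B13CarriersTranslation` — `TDom.translate`,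
`Dom.translate`∕`d_translate`, `tadj_add_iff` — and route P2's `B13DomainGeometryTR`; nothing existing is edited).
* §1 `mulHom` (`ℤ∕N →+ ℤ∕N′`, `x ↦ c·x`, well defined WHEN `N′ = c·N`, via `ZMod.lift`), `mulHom_apply`∕`val_mulHom`; the range
  arithmetic `cubesPerDir_eq_pow_mul` (`N_j = L^{k−j}·N_k` for `j ≤ k`, `k + m′ ≤ m + K`) and `sitesPerDir_eq_pow_mul`; the induced
  translations `liftVec R k j : (ℤ∕N_k)⁴ →+ (ℤ∕N_j)⁴` and `siteVec R k i : (ℤ∕N_k)⁴ →+ (sites of T^{(i)})` — multiplication by the right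
  power of `L` in range and the ZERO map on junk scales (where the tori are truncated to two cubes per direction, `B13Carriers` (iii),
  and no covariance is claimed); `liftVec_self`; the KEY LEMMAS **`coarsen_add_liftVec`** and **`toCube_add_siteVec`** (coarsening
  INTERTWINES the induced translations), both from one arithmetic fact `natCast_mod_mul_div` (`((y mod c·N) ∕ c : ℤ∕N) = (y ∕ c : ℤ∕N)`).
* §2 the ACTIONS: `translateAt R k v` on domain indices (a scale-`j` domain moves by `liftVec R k j v`; `translateAt_zero`∕`_add`∕
  `_injective`, `d_translateAt`, `card_translateAt`), `cubeTranslate` on sigma cubes (`footprint_translateAt`,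
  `footprint_subset_translateAt_iff`), **`touch_image_iff`** — the touching relation ζ of [II] (2.11) is translation invariant
  (fibrewise leaf-05's `tadj_add_iff`; different scales never touch) — and `bondTranslate` on the level-tagged bonds `B13InnerData.Bnd R`
  (`shift_add`, `tgt_bondTranslate`, `bondTranslate_zero`∕`_add`∕`_injective`).
NOT an estimate; no END face or consumer touched.  0 sorry; axioms ⊆ {propext, Classical.choice, Quot.sound}.
-/

noncomputable section

namespace Summit.QuantumFields.BalabanUV.T4Continuum.B13StepTermShift

open scoped BigOperators
open Literature.MathematicalPhysics.QuantumFieldTheory.Balaban1983to89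
open Literature.MathematicalPhysics.QuantumFieldTheory.Balaban1983to89.TreeLengthTorus (TPt TDom TAdj torusTreeLen)
open Summit.QuantumFields.BalabanUV.T4Continuum.B13Carriers (TwoRuns)
open Summit.QuantumFields.BalabanUV.T4Continuum.B13CarriersTranslation (tadj_add_iff mem_image_add_iff)
open Summit.QuantumFields.BalabanUV.T4Continuum.B13CarriersFootprint (toCube toCube_apply)
open Summit.QuantumFields.BalabanUV.T4Continuum.B13InnerData (Bnd coarsen coarsen_apply)
open Summit.QuantumFields.BalabanUV.T4Continuum.B13DomainGeometryTR (SCube SAdj embed footprint touch sAdj_mk_iff fst_eq_of_sAdj)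

/-! ## §1 Multiplication between cyclic groups; the induced translations across levels; intertwining with coarsening -/

section Arithmetic

/-- [folklore] ONE ARITHMETIC FACT behind cross-level covariance: reducing `y` modulo `c·N` does not change `⌊y∕c⌋` modulo `N`. -/
theorem natCast_mod_mul_div (y c N : ℕ) (hc : 0 < c) :
    (((y % (c * N)) / c : ℕ) : ZMod N) = ((y / c : ℕ) : ZMod N) := by
  conv_rhs => rw [← Nat.mod_add_div y (c * N)]
  rw [show c * N * (y / (c * N)) = c * (N * (y / (c * N))) by ring, Nat.add_mul_div_left _ _ hc]
  push_cast
  rw [ZMod.natCast_self, zero_mul, add_zero]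

/-- [folklore] MULTIPLICATION BY `c` from `ℤ∕N` to `ℤ∕N′` when `N′ = c·N`: a well-defined additive homomorphism (`ZMod.lift` of
`n ↦ c·n`, which kills `N` because `c·N = N′ = 0` in `ℤ∕N′`). -/
def mulHom {N N' : ℕ} (c : ℕ) (h : N' = c * N) : ZMod N →+ ZMod N' :=
  ZMod.lift N ⟨(AddMonoidHom.mulLeft (c : ZMod N')).comp (Int.castAddHom (ZMod N')), by
    show (c : ZMod N') * ((N : ℤ) : ZMod N') = 0
    rw [Int.cast_natCast, ← Nat.cast_mul, ← h, ZMod.natCast_self]⟩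

/-- [folklore] `mulHom c` on representatives: `x ↦ c·x.val (mod N′)`. -/
theorem mulHom_apply {N N' : ℕ} [NeZero N] (c : ℕ) (h : N' = c * N) (x : ZMod N) :
    mulHom c h x = ((c * x.val : ℕ) : ZMod N') := by
  conv_lhs => rw [← ZMod.natCast_zmod_val x, ← Int.cast_natCast]
  rw [mulHom, ZMod.lift_coe]
  simp [Nat.cast_mul]

/-- [folklore] The representative of `mulHom c x` is `c·x.val` on the nose (no reduction: `c·x.val < c·N = N′`). -/
theorem val_mulHom {N N' : ℕ} [NeZero N] [NeZero N'] (c : ℕ) (h : N' = c * N) (x : ZMod N) :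
    (mulHom c h x).val = c * x.val := by
  rw [mulHom_apply, ZMod.val_natCast]
  refine Nat.mod_eq_of_lt ?_
  have hc : 0 < c := Nat.pos_of_ne_zero fun hc => NeZero.ne N' (by rw [h, hc, zero_mul])
  calc c * x.val < c * N := Nat.mul_lt_mul_of_pos_left (ZMod.val_lt x) hc
    _ = N' := h.symm

/-- [folklore] THE CORE COMPUTATION: dividing the representative of `a + c·t` by `c′`, where the modulus is `c′·M` and `c = c′·e`,
gives `⌊a∕c′⌋ + e·t` modulo `M`. -/
theorem natCast_div_val_add {S : ℕ} [NeZero S] (a : ZMod S) (t c c' e M : ℕ) (hS : S = c' * M) (hc : c = c' * e)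
    (hc' : 0 < c') :
    ((((a + ((c * t : ℕ) : ZMod S)).val / c' : ℕ)) : ZMod M) = ((a.val / c' : ℕ) : ZMod M) + ((e * t : ℕ) : ZMod M) := by
  subst hS hc
  rw [ZMod.val_add, ZMod.val_natCast, Nat.add_mod_mod, natCast_mod_mul_div _ _ _ hc', mul_assoc,
    Nat.add_mul_div_left _ _ hc', Nat.cast_add]

end Arithmetic

variable {G : Type} [GaugeGroup G] (R : TwoRuns G)

/-- [folklore] `0 < L` (the block size is `> 1`). -/
theorem L_pos : 0 < R.F.L := by have := R.F.hL.2; omega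

/-- [folklore] RANGE ARITHMETIC for cubes: for `j ≤ k` and the output scale in the meaningful range `k + m′ ≤ m + K`,
`N_j = L^{k−j}·N_k` ([Balaban1987RG1] p. 257: the cubes of `π_j` have side `L^{m′}` on `T^{(j)}`; `B13Carriers.TwoRuns.cubesPerDir_eq`). -/
theorem cubesPerDir_eq_pow_mul {j k : ℕ} (hjk : j ≤ k) (hk : k + R.m' ≤ R.F.m + R.K) :
    R.cubesPerDir j = R.F.L ^ (k - j) * R.cubesPerDir k := by
  rw [R.cubesPerDir_eq, R.cubesPerDir_eq]
  have hsplit : R.F.m + R.K - (j + R.m') = (k - j) + (R.F.m + R.K - (k + R.m')) := by omega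
  rw [hsplit, pow_add]
  ring

/-- [folklore] RANGE ARITHMETIC for sites: for `i ≤ k + m′` and `k + m′ ≤ m + K`, `#sites of T^{(i)} per direction = L^{k+m′−i}·N_k`. -/
theorem sitesPerDir_eq_pow_mul {i k : ℕ} (hik : i ≤ k + R.m') (hk : k + R.m' ≤ R.F.m + R.K) :
    (R.F.P R.K).sitesPerDir i = R.F.L ^ (k + R.m' - i) * R.cubesPerDir k := by
  rw [R.cubesPerDir_eq]
  simp only [Params.sitesPerDir, T4Continuum.T4Family.P_L, T4Continuum.T4Family.P_m, T4Continuum.T4Family.P_K]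
  have hsplit : R.F.m + R.K - i = (k + R.m' - i) + (R.F.m + R.K - (k + R.m')) := by omega
  rw [hsplit, pow_add]
  ring

/-- [folklore] THE INDUCED TRANSLATION OF LEVEL-`j` CUBE INDICES by a level-`k` vector `v`: multiplication by `L^{k−j}` (a cube of
`π_k` is a block of `L^{k−j}` cubes of `π_j` per direction) when `N_j = L^{k−j}·N_k`, the ZERO map otherwise (junk scales — no
covariance is claimed there).  An additive homomorphism `(ℤ∕N_k)⁴ →+ (ℤ∕N_j)⁴` in either case. -/
def liftVec (k j : ℕ) : TPt 4 (R.cubesPerDir k) →+ TPt 4 (R.cubesPerDir j) :=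
  if h : R.cubesPerDir j = R.F.L ^ (k - j) * R.cubesPerDir k then (mulHom (R.F.L ^ (k - j)) h).compLeft (Fin 4) else 0

/-- [folklore] THE INDUCED TRANSLATION OF LEVEL-`i` SITES by a level-`k` vector `v`: multiplication by `L^{k+m′−i}` when
`#sites = L^{k+m′−i}·N_k`, zero otherwise. -/
def siteVec (k i : ℕ) : TPt 4 (R.cubesPerDir k) →+ TPt 4 ((R.F.P R.K).sitesPerDir i) :=
  if h : (R.F.P R.K).sitesPerDir i = R.F.L ^ (k + R.m' - i) * R.cubesPerDir k then
    (mulHom (R.F.L ^ (k + R.m' - i)) h).compLeft (Fin 4) else 0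

/-- [folklore] `liftVec` in range, coordinatewise on representatives. -/
theorem liftVec_apply {k j : ℕ} (h : R.cubesPerDir j = R.F.L ^ (k - j) * R.cubesPerDir k) (v : TPt 4 (R.cubesPerDir k))
    (ν : Fin 4) : liftVec R k j v ν = ((R.F.L ^ (k - j) * (v ν).val : ℕ) : ZMod (R.cubesPerDir j)) := by
  simp only [liftVec, dif_pos h, AddMonoidHom.compLeft_apply, Function.comp_apply, mulHom_apply]

/-- [folklore] `siteVec` in range, coordinatewise on representatives. -/
theorem siteVec_apply {k i : ℕ} (h : (R.F.P R.K).sitesPerDir i = R.F.L ^ (k + R.m' - i) * R.cubesPerDir k)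
    (v : TPt 4 (R.cubesPerDir k)) (ν : Fin 4) :
    siteVec R k i v ν = ((R.F.L ^ (k + R.m' - i) * (v ν).val : ℕ) : ZMod ((R.F.P R.K).sitesPerDir i)) := by
  simp only [siteVec, dif_pos h, AddMonoidHom.compLeft_apply, Function.comp_apply, mulHom_apply]

/-- [folklore] At the reference level itself the induced translation is the translation: `liftVec R k k v = v`. -/
@[simp] theorem liftVec_self (k : ℕ) (v : TPt 4 (R.cubesPerDir k)) : liftVec R k k v = v := by
  have h : R.cubesPerDir k = R.F.L ^ (k - k) * R.cubesPerDir k := by rw [Nat.sub_self, pow_zero, one_mul]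
  funext ν
  rw [liftVec_apply R h, Nat.sub_self, pow_zero, one_mul, ZMod.natCast_zmod_val]

/-- [folklore] **COARSENING INTERTWINES THE INDUCED TRANSLATIONS** (`i ≤ j ≤ k`, output scale in range): coarsening a translated
level-`i` cube index to level `j` = translating the coarsened index by the level-`j` induced vector. -/
theorem coarsen_add_liftVec {i j k : ℕ} (hij : i ≤ j) (hjk : j ≤ k) (hk : k + R.m' ≤ R.F.m + R.K)
    (a : TPt 4 (R.cubesPerDir i)) (v : TPt 4 (R.cubesPerDir k)) :
    coarsen R i j (a + liftVec R k i v) = coarsen R i j a + liftVec R k j v := by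
  have hi := cubesPerDir_eq_pow_mul R (hij.trans hjk) hk
  have hj := cubesPerDir_eq_pow_mul R hjk hk
  have hS : R.cubesPerDir i = R.F.L ^ (j - i) * R.cubesPerDir j := by
    rw [hi, hj, ← mul_assoc, ← pow_add]; congr 2; omega
  funext ν
  rw [Pi.add_apply, coarsen_apply, coarsen_apply, Pi.add_apply, liftVec_apply R hi, liftVec_apply R hj]
  exact natCast_div_val_add (a ν) (v ν).val _ _ (R.F.L ^ (k - j)) _ hS (by rw [← pow_add]; congr 1; omega)
    (pow_pos (L_pos R) _)

/-- [folklore] **`toCube` INTERTWINES THE INDUCED TRANSLATIONS** (`i ≤ j + m′`, `j ≤ k`, output scale in range): the cube of `π_j`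
containing a level-`i` site translated by `siteVec R k i v` is the cube of the site translated by `liftVec R k j v`. -/
theorem toCube_add_siteVec {i j k : ℕ} (hij : i ≤ j + R.m') (hjk : j ≤ k) (hk : k + R.m' ≤ R.F.m + R.K)
    (x : Site (R.F.P R.K) i) (v : TPt 4 (R.cubesPerDir k)) :
    toCube R i j (fun ν => x ν + siteVec R k i v ν) = toCube R i j x + liftVec R k j v := by
  have hi := sitesPerDir_eq_pow_mul R (hij.trans (by omega)) hk
  have hj := cubesPerDir_eq_pow_mul R hjk hk
  have hS : (R.F.P R.K).sitesPerDir i = R.F.L ^ (j + R.m' - i) * R.cubesPerDir j := by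
    rw [hi, hj, ← mul_assoc, ← pow_add]; congr 2; omega
  funext ν
  rw [toCube_apply, Pi.add_apply, toCube_apply, siteVec_apply R hi, liftVec_apply R hj]
  exact natCast_div_val_add (x ν) (v ν).val _ _ (R.F.L ^ (k - j)) _ hS (by rw [← pow_add]; congr 1; omega)
    (pow_pos (L_pos R) _)

/-! ## §2 The actions on domain indices, sigma cubes and bonds; invariance of the touching relation -/

section Action

variable {R}

/-- [folklore] THE INDUCED TRANSLATION OF A DOMAIN INDEX by a level-`k` vector: a domain of scale `j` moves by `liftVec R k j v` on
its own torus `π_j` (leaf-05's `Dom.translate`; same scale, same tree length). -/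
def translateAt (k : ℕ) (v : TPt 4 (R.cubesPerDir k)) (Y : R.carriers.Dom) : R.carriers.Dom :=
  B13CarriersTranslation.Dom.translate Y (liftVec R k Y.1 v)

/-- [folklore] The scale of a translated domain (definitional). -/
@[simp] theorem translateAt_fst (k : ℕ) (v : TPt 4 (R.cubesPerDir k)) (Y : R.carriers.Dom) : (translateAt k v Y).1 = Y.1 := rfl

/-- [folklore] The cube family of a translated domain (definitional). -/
@[simp] theorem translateAt_snd_val (k : ℕ) (v : TPt 4 (R.cubesPerDir k)) (Y : R.carriers.Dom) :
    (translateAt k v Y).2.1 = Y.2.1.image (· + liftVec R k Y.1 v) := rfl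

/-- [folklore] At the reference level the induced translation is leaf-05's translation by `v` itself. -/
theorem translateAt_self {k : ℕ} (Y : TDom 4 (R.cubesPerDir k)) (v : TPt 4 (R.cubesPerDir k)) :
    translateAt k v (⟨k, Y⟩ : R.carriers.Dom) = B13CarriersTranslation.Dom.translate (⟨k, Y⟩ : R.carriers.Dom) v := by
  simp only [translateAt, liftVec_self]

/-- [folklore] The tree length is invariant (leaf-05's `Dom.d_translate`). -/
@[simp] theorem d_translateAt (k : ℕ) (v : TPt 4 (R.cubesPerDir k)) (Y : R.carriers.Dom) :
    R.carriers.d (translateAt k v Y) = R.carriers.d Y :=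
  B13CarriersTranslation.Dom.d_translate Y _

/-- [folklore] The number of cubes is invariant. -/
@[simp] theorem card_translateAt (k : ℕ) (v : TPt 4 (R.cubesPerDir k)) (Y : R.carriers.Dom) :
    (translateAt k v Y).2.1.card = Y.2.1.card :=
  B13CarriersTranslation.TDom.card_translate _ Y.2

/-- [folklore] Translating a cube family by `0` is the identity. -/
theorem image_add_zero {M : ℕ} (S : Finset (TPt 4 M)) : S.image (· + (0 : TPt 4 M)) = S := by
  simp

/-- [folklore] Translating a cube family by `a` then `b` is translating by `a + b`. -/
theorem image_add_image_add {M : ℕ} (S : Finset (TPt 4 M)) (a b : TPt 4 M) :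
    (S.image (· + a)).image (· + b) = S.image (· + (a + b)) := by
  rw [Finset.image_image]; congr 1; funext x; simp [add_assoc]

/-- [folklore] ACTION, unit: translating by `0` is the identity on domains. -/
@[simp] theorem translateAt_zero (k : ℕ) (Y : R.carriers.Dom) : translateAt k (0 : TPt 4 (R.cubesPerDir k)) Y = Y := by
  obtain ⟨j, Y⟩ := Y
  refine Sigma.ext rfl (heq_of_eq (Subtype.ext ?_))
  simp only [translateAt_snd_val, map_zero, image_add_zero]

/-- [folklore] ACTION, multiplication: translating by `v + w` is translating by `v` then by `w`. -/
theorem translateAt_add (k : ℕ) (v w : TPt 4 (R.cubesPerDir k)) (Y : R.carriers.Dom) :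
    translateAt k (v + w) Y = translateAt k w (translateAt k v Y) := by
  obtain ⟨j, Y⟩ := Y
  refine Sigma.ext rfl (heq_of_eq (Subtype.ext ?_))
  show Y.1.image (· + liftVec R k j (v + w)) = (Y.1.image (· + liftVec R k j v)).image (· + liftVec R k j w)
  rw [map_add, image_add_image_add]

/-- [folklore] Translation of domains by a fixed vector is injective (it has the inverse `translateAt k (−v)`). -/
theorem translateAt_injective (k : ℕ) (v : TPt 4 (R.cubesPerDir k)) : Function.Injective (translateAt (R := R) k v) := by
  intro Y Y' h
  have h' := congrArg (translateAt k (-v)) h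
  rwa [← translateAt_add, ← translateAt_add, add_neg_cancel, translateAt_zero, translateAt_zero] at h'

/-- [folklore] THE INDUCED TRANSLATION OF A SIGMA CUBE (a cube of `π_j` moves by `liftVec R k j v`). -/
def cubeTranslate (k : ℕ) (v : TPt 4 (R.cubesPerDir k)) (c : SCube R) : SCube R := ⟨c.1, c.2 + liftVec R k c.1 v⟩

/-- [folklore] Cube translation by a fixed vector is injective. -/
theorem cubeTranslate_injective (k : ℕ) (v : TPt 4 (R.cubesPerDir k)) : Function.Injective (cubeTranslate (R := R) k v) := by
  rintro ⟨j, a⟩ ⟨j', b⟩ h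
  obtain ⟨rfl, h2⟩ := Sigma.mk.inj_iff.1 h
  have hab : a + liftVec R k j v = b + liftVec R k j v := eq_of_heq h2
  rw [add_left_injective _ hab]

/-- [folklore] The footprint of a translated domain is the translated footprint. -/
theorem footprint_translateAt (k : ℕ) (v : TPt 4 (R.cubesPerDir k)) (Y : R.carriers.Dom) :
    footprint (translateAt k v Y) = (footprint Y).image (cubeTranslate k v) := by
  obtain ⟨j, Y⟩ := Y
  simp only [footprint, Finset.map_eq_image, Finset.image_image, translateAt_fst, translateAt_snd_val]
  congr 1

/-- [folklore] FOOTPRINT INCLUSION IS TRANSLATION INVARIANT. -/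
theorem footprint_subset_translateAt_iff (k : ℕ) (v : TPt 4 (R.cubesPerDir k)) (Y X : R.carriers.Dom) :
    footprint (translateAt k v Y) ⊆ footprint (translateAt k v X) ↔ footprint Y ⊆ footprint X := by
  rw [footprint_translateAt, footprint_translateAt, Finset.image_subset_image_iff (cubeTranslate_injective k v)]

/-- [folklore] WALL ADJACENCY OF SIGMA CUBES IS TRANSLATION INVARIANT (fibrewise leaf-05's `tadj_add_iff`; across fibres there is no
adjacency). -/
theorem sAdj_cubeTranslate_iff (k : ℕ) (v : TPt 4 (R.cubesPerDir k)) (a b : SCube R) :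
    SAdj R (cubeTranslate k v a) (cubeTranslate k v b) ↔ SAdj R a b := by
  obtain ⟨j, a⟩ := a; obtain ⟨j', b⟩ := b
  constructor
  · intro h
    have hjj : j = j' := fst_eq_of_sAdj h
    subst hjj
    exact sAdj_mk_iff.2 ((tadj_add_iff a b _).1 (sAdj_mk_iff.1 h))
  · intro h
    have hjj : j = j' := fst_eq_of_sAdj h
    subst hjj
    exact sAdj_mk_iff.2 ((tadj_add_iff a b _).2 (sAdj_mk_iff.1 h))

/-- [folklore] **THE TOUCHING RELATION ζ OF (2.11) IS TRANSLATION INVARIANT** ([II] p. 14: *"ζ(Z, Z′) = 0 if Z ∩ Z′ contains a cube,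
or a wall of a cube"*; on the homogeneous torus of [Balaban1987RG1] p. 251 this is a statement about relative positions). -/
theorem touch_image_iff (k : ℕ) (v : TPt 4 (R.cubesPerDir k)) (Fs Gs : Finset (SCube R)) :
    touch (Fs.image (cubeTranslate k v)) (Gs.image (cubeTranslate k v)) ↔ touch Fs Gs := by
  constructor
  · rintro ⟨a', ha', b', hb', hab⟩
    obtain ⟨a, ha, rfl⟩ := Finset.mem_image.1 ha'
    obtain ⟨b, hb, rfl⟩ := Finset.mem_image.1 hb'
    refine ⟨a, ha, b, hb, ?_⟩
    rcases hab with hab | hab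
    · exact Or.inl (cubeTranslate_injective k v hab)
    · exact Or.inr ((sAdj_cubeTranslate_iff k v a b).1 hab)
  · rintro ⟨a, ha, b, hb, hab⟩
    refine ⟨cubeTranslate k v a, Finset.mem_image_of_mem _ ha, cubeTranslate k v b, Finset.mem_image_of_mem _ hb, ?_⟩
    rcases hab with hab | hab
    · exact Or.inl (by rw [hab])
    · exact Or.inr ((sAdj_cubeTranslate_iff k v a b).2 hab)

/-- [folklore] THE INDUCED TRANSLATION OF A BOND (tagged by its level `i`): the source moves by `siteVec R k i v`, the direction is kept. -/
def bondTranslate (k : ℕ) (v : TPt 4 (R.cubesPerDir k)) (b : Bnd R) : Bnd R :=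
  ⟨b.1, ⟨fun ν => b.2.src ν + siteVec R k b.1 v ν, b.2.dir⟩⟩

/-- [folklore] The level of a translated bond (definitional). -/
@[simp] theorem bondTranslate_fst (k : ℕ) (v : TPt 4 (R.cubesPerDir k)) (b : Bnd R) : (bondTranslate k v b).1 = b.1 := rfl

variable (R) in
/-- [folklore] Translating a site commutes with the lattice step `x ↦ x + e_μ` (`Site.shift`). -/
theorem shift_add {i : ℕ} (x : Site (R.F.P R.K) i) (w : TPt 4 ((R.F.P R.K).sitesPerDir i)) (μ : Fin 4) :
    Site.shift (P := R.F.P R.K) (fun ν => x ν + w ν) μ = fun ν => Site.shift x μ ν + w ν := by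
  funext ν
  simp only [Site.shift, Function.update_apply]
  split_ifs with h
  · subst h
    exact add_right_comm _ _ _
  · rfl

/-- [folklore] The target of a translated bond is the translated target. -/
theorem tgt_bondTranslate (k : ℕ) (v : TPt 4 (R.cubesPerDir k)) (b : Bnd R) (ν : Fin 4) :
    (bondTranslate k v b).2.tgt ν = b.2.tgt ν + siteVec R k b.1 v ν := by
  obtain ⟨i, src, dir⟩ := b
  simp only [bondTranslate, PBond.tgt, shift_add R src (siteVec R k i v) dir]

/-- [folklore] ACTION on bonds, unit. -/
@[simp] theorem bondTranslate_zero (k : ℕ) (b : Bnd R) : bondTranslate k (0 : TPt 4 (R.cubesPerDir k)) b = b := by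
  obtain ⟨i, src, dir⟩ := b
  simp only [bondTranslate, map_zero]
  congr 2
  funext ν
  exact add_zero (src ν)

/-- [folklore] ACTION on bonds, multiplication. -/
theorem bondTranslate_add (k : ℕ) (v w : TPt 4 (R.cubesPerDir k)) (b : Bnd R) :
    bondTranslate k (v + w) b = bondTranslate k w (bondTranslate k v b) := by
  obtain ⟨i, src, dir⟩ := b
  simp only [bondTranslate, map_add]
  congr 2
  funext ν
  exact (add_assoc (src ν) _ _).symm

/-- [folklore] Bond translation by a fixed vector is injective. -/
theorem bondTranslate_injective (k : ℕ) (v : TPt 4 (R.cubesPerDir k)) : Function.Injective (bondTranslate (R := R) k v) := by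
  intro b b' h
  have h' := congrArg (bondTranslate k (-v)) h
  rwa [← bondTranslate_add, ← bondTranslate_add, add_neg_cancel, bondTranslate_zero, bondTranslate_zero] at h'


end Action

end Summit.QuantumFields.BalabanUV.T4Continuum.B13StepTermShift

end
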